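import Mathlib.Tactic
import HarnessLib

/-!
# Kozma–Nitzan's Question 8 at three relays — PROPOSITION 5c core (gen 20): on a CHAIN of classes, `D · D′ ≤ (1 − Φ)(Φ + m)`

Support file (`--supports stmt-CriticalPhenomena-4575`, closed crux; independent mathematics on Kozma–Nitzan's Question 8,
arXiv:2401.12397 §5.5 p. 36), prover `prim-ineq-gen-6` (gen 20).  No definitions, no named facts, no sorries; standard axioms.
Memo `run/shared/lean/prim/prim-ineq-gen-6/FINDING-G20.md` §5c: for a pendant PATH rooted at an end the classes (root fragments) form a chain
`R₀ ⊂ R₁ ⊂ …`, so the attachment parameters `A_k = ∏ A_z`, `C_k = ∏ C_z` are non-increasing in `k`; with class weights `ω_k ≥ 0`, tilts `p_k ∈ [0,1]`,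
`u_k = p_k A_k (1 − C_k)` (so `D = Σ ω u`), `w_k = p_k C_k (1 − A_k)` (`D′ = π − m = Σ ω w`), `g_k = p_k (A_k + C_k)` (`Φ + m = Σ ω g`) and
`φ′_k = 1 − p_k (A_k + C_k − A_k C_k)` (`1 − Φ = Σ ω φ′` when `Σ ω = 1`):
      `(Σ_i ω_i u_i)(Σ_k ω_k w_k) ≤ (Σ_k ω_k φ′_k)(Σ_i ω_i g_i)`      (`chainDD_le`).
Together with LEMMA W (`…KnQuestion8AttachMonotone.lean`) this gives `D(πΦ − m) ≤ Φ(Φ+m)(1−Φ)`, i.e. the first scalar condition `κ₀ ≤ 0` of THEOREM 5a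
(the C2 corner of the κ = 2 coefficient for path-end blocks holds iff it holds for the single-site functionals), i.e. `B̃_{C2}[1{a ∈ U}] ≥ 0`.
The proof is the symmetrised termwise inequality `u_i w_k + u_k w_i ≤ φ′_k g_i + φ′_i g_k` for comparable `(A_i,C_i) ≥ (A_k,C_k)` (`chainDD_pair`) summed over
all ordered pairs.  [cite: KozmaNitzan2024, Question 8 (§5.5 p. 36)]
-/

namespace Summit.CriticalPhenomena.PercolationContinuityZ3.Theorems

namespace PocketCert

open Finset

/-- **Pair inequality.**  For `p, p' ∈ [0,1]` and `0 ≤ A' ≤ A ≤ 1`, `0 ≤ C' ≤ C ≤ 1` (the later class `(A',C')` lies below the earlier one):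
`u w' + u' w ≤ φ'(A',C',p')·g(A,C,p) + φ'(A,C,p)·g(A',C',p')`.  [cite: KozmaNitzan2024, Question 8 (§5.5 p. 36)] -/
theorem chainDD_pair (p p' A A' C C' : ℝ) (hp0 : 0 ≤ p) (hp1 : p ≤ 1) (hq0 : 0 ≤ p') (hq1 : p' ≤ 1)
    (hA'0 : 0 ≤ A') (hA'A : A' ≤ A) (hA1 : A ≤ 1) (hC'0 : 0 ≤ C') (hC'C : C' ≤ C) (hC1 : C ≤ 1) :
    (p * A * (1 - C)) * (p' * C' * (1 - A')) + (p' * A' * (1 - C')) * (p * C * (1 - A))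
      ≤ (1 - p' * (A' + C' - A' * C')) * (p * (A + C)) + (1 - p * (A + C - A * C)) * (p' * (A' + C')) := by
  have hA0 : 0 ≤ A := le_trans hA'0 hA'A
  have hC0 : 0 ≤ C := le_trans hC'0 hC'C
  have hA'1 : A' ≤ 1 := le_trans hA'A hA1
  have hC'1 : C' ≤ 1 := le_trans hC'C hC1
  -- (a) the cross terms are bounded by p p' (1 − M')(A C' + A' C) where 1 − M' = (1 − A')(1 − C')
  have h1 : (p * A * (1 - C)) * (p' * C' * (1 - A')) ≤ p * p' * A * C' * ((1 - A') * (1 - C')) := by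
    have : (1 - C) ≤ (1 - C') := by linarith
    have hnn : 0 ≤ p * p' * A * C' * (1 - A') := by positivity
    nlinarith [mul_le_mul_of_nonneg_left this hnn]
  have h2 : (p' * A' * (1 - C')) * (p * C * (1 - A)) ≤ p * p' * A' * C * ((1 - A') * (1 - C')) := by
    have : (1 - A) ≤ (1 - A') := by linarith
    have hnn : 0 ≤ p * p' * A' * C * (1 - C') := by positivity
    nlinarith [mul_le_mul_of_nonneg_left this hnn]
  -- (b) A C' + A' C ≤ A + C and p'(1 − M') ≤ 1 − p' M'
  have h3 : A * C' + A' * C ≤ A + C := by nlinarith [mul_le_mul_of_nonneg_left hC'1 hA0, mul_le_mul_of_nonneg_left hA'1 hC0]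
  have hM' : 0 ≤ (1 - A') * (1 - C') := mul_nonneg (by linarith) (by linarith)
  have h4 : p' * ((1 - A') * (1 - C')) ≤ 1 - p' * (A' + C' - A' * C') := by nlinarith
  have h5 : 0 ≤ (1 - p * (A + C - A * C)) * (p' * (A' + C')) := by
    apply mul_nonneg
    · have : A + C - A * C ≤ 1 := by nlinarith [mul_nonneg (sub_nonneg.2 hA1) (sub_nonneg.2 hC1)]
      nlinarith [mul_le_mul_of_nonneg_left this hp0]
    · positivity
  have h6 : p * p' * A * C' * ((1 - A') * (1 - C')) + p * p' * A' * C * ((1 - A') * (1 - C'))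
      = (p' * ((1 - A') * (1 - C'))) * (p * (A * C' + A' * C)) := by ring
  have h7 : (p' * ((1 - A') * (1 - C'))) * (p * (A * C' + A' * C)) ≤ (1 - p' * (A' + C' - A' * C')) * (p * (A + C)) := by
    have hx : 0 ≤ p' * ((1 - A') * (1 - C')) := by positivity
    have hy : 0 ≤ p * (A + C) := by positivity
    calc (p' * ((1 - A') * (1 - C'))) * (p * (A * C' + A' * C))
        ≤ (p' * ((1 - A') * (1 - C'))) * (p * (A + C)) := by
          apply mul_le_mul_of_nonneg_left _ hx; exact mul_le_mul_of_nonneg_left h3 hp0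
      _ ≤ (1 - p' * (A' + C' - A' * C')) * (p * (A + C)) := mul_le_mul_of_nonneg_right h4 hy
  linarith [h1, h2, h6, h7, h5]

/-- **`D·D′ ≤ (1 − Φ)(Φ + m)` on a chain of classes** (PROPOSITION 5c core).  Indices `i < n`; `A`, `C` non-increasing; `ω ≥ 0`; `p, A, C ∈ [0,1]`.
[cite: KozmaNitzan2024, Question 8 (§5.5 p. 36)] -/
theorem chainDD_le (n : ℕ) (ω p A C : ℕ → ℝ) (hω : ∀ i, 0 ≤ ω i) (hp0 : ∀ i, 0 ≤ p i) (hp1 : ∀ i, p i ≤ 1)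
    (hA0 : ∀ i, 0 ≤ A i) (hA1 : ∀ i, A i ≤ 1) (hC0 : ∀ i, 0 ≤ C i) (hC1 : ∀ i, C i ≤ 1)
    (hAmono : ∀ i k, i ≤ k → A k ≤ A i) (hCmono : ∀ i k, i ≤ k → C k ≤ C i) :
    (∑ i ∈ range n, ω i * (p i * A i * (1 - C i))) * (∑ k ∈ range n, ω k * (p k * C k * (1 - A k)))
      ≤ (∑ k ∈ range n, ω k * (1 - p k * (A k + C k - A k * C k))) * (∑ i ∈ range n, ω i * (p i * (A i + C i))) := by
  -- termwise symmetrised inequality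
  have pair : ∀ i k, ω i * (p i * A i * (1 - C i)) * (ω k * (p k * C k * (1 - A k)))
      + ω k * (p k * A k * (1 - C k)) * (ω i * (p i * C i * (1 - A i)))
      ≤ ω k * (1 - p k * (A k + C k - A k * C k)) * (ω i * (p i * (A i + C i)))
      + ω i * (1 - p i * (A i + C i - A i * C i)) * (ω k * (p k * (A k + C k))) := by
    intro i k
    have hwik : 0 ≤ ω i * ω k := mul_nonneg (hω i) (hω k)
    rcases le_total i k with hik | hki
    · have h := chainDD_pair (p i) (p k) (A i) (A k) (C i) (C k) (hp0 i) (hp1 i) (hp0 k) (hp1 k)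
        (hA0 k) (hAmono i k hik) (hA1 i) (hC0 k) (hCmono i k hik) (hC1 i)
      have := mul_le_mul_of_nonneg_left h hwik
      nlinarith [this]
    · have h := chainDD_pair (p k) (p i) (A k) (A i) (C k) (C i) (hp0 k) (hp1 k) (hp0 i) (hp1 i)
        (hA0 i) (hAmono k i hki) (hA1 k) (hC0 i) (hCmono k i hki) (hC1 k)
      have := mul_le_mul_of_nonneg_left h hwik
      nlinarith [this]
  -- sum over all ordered pairs: 2·LHS ≤ 2·RHS
  have hsum := Finset.sum_le_sum (s := range n) fun i _ =>
    Finset.sum_le_sum (s := range n) fun k _ => pair i k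
  simp only [Finset.sum_add_distrib] at hsum
  have e1 : ∑ i ∈ range n, ∑ k ∈ range n, ω i * (p i * A i * (1 - C i)) * (ω k * (p k * C k * (1 - A k)))
      = (∑ i ∈ range n, ω i * (p i * A i * (1 - C i))) * (∑ k ∈ range n, ω k * (p k * C k * (1 - A k))) := by
    rw [Finset.sum_mul_sum]
  have e2 : ∑ i ∈ range n, ∑ k ∈ range n, ω k * (p k * A k * (1 - C k)) * (ω i * (p i * C i * (1 - A i)))
      = (∑ i ∈ range n, ω i * (p i * A i * (1 - C i))) * (∑ k ∈ range n, ω k * (p k * C k * (1 - A k))) := by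
    rw [Finset.sum_comm, Finset.sum_mul_sum]
  have e3 : ∑ i ∈ range n, ∑ k ∈ range n, ω k * (1 - p k * (A k + C k - A k * C k)) * (ω i * (p i * (A i + C i)))
      = (∑ k ∈ range n, ω k * (1 - p k * (A k + C k - A k * C k))) * (∑ i ∈ range n, ω i * (p i * (A i + C i))) := by
    rw [Finset.sum_comm, Finset.sum_mul_sum]
  have e4 : ∑ i ∈ range n, ∑ k ∈ range n, ω i * (1 - p i * (A i + C i - A i * C i)) * (ω k * (p k * (A k + C k)))
      = (∑ k ∈ range n, ω k * (1 - p k * (A k + C k - A k * C k))) * (∑ i ∈ range n, ω i * (p i * (A i + C i))) := by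
    rw [Finset.sum_mul_sum]
  rw [e1, e2, e3, e4] at hsum
  linarith

end PocketCert

end Summit.CriticalPhenomena.PercolationContinuityZ3.Theorems
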